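import Mathlib
import HarnessLib
import Summits.Ventures.LatticeQCDFlow.Statement
import Summits.Ventures.LatticeQCDFlow.TrivializingMaps.TruncatedFlowLightCone
import Summits.Ventures.LatticeQCDFlow.TrivializingMaps.TruncatedFlowReceptiveField
import Summits.Ventures.LatticeQCDFlow.TrivializingMaps.TruncatedFlowAcceptanceFootprint

/-!
# Venture statement — LatticeQCDFlow — DRAFT, Part T7–T9: LOCALITY OF THE FLOW-DEFINED MAPS

HONEST FRAMING: exact (Metropolis-corrected) sampling algorithms for lattice gauge theory;
figures of merit are autocorrelation/cost numbers at stated couplings and volumes; no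
continuum-physics claim.

This file CONTINUES the venture's `Statement.lean` DRAFT (FANOUT-PLAN.md row 31, lean-2; review-queued;
it STAYS A DRAFT until the operator adopts it).  It is a separate module only because `Statement.lean`
has reached the tree's 400-line limit; on adoption the operator may merge the two.  As in Parts T–T6,
every `Prop` below is a typed statement over the landed substrate with a `_holds` theorem next to it,
and `TheoryStatementT9 := TheoryStatementT6 ∧ T7 ∧ T8 ∧ T9` is PROVED.  The theory brief's question
"locality of the flow-defined map, how the required network size / training cost must scale with VOLUME
and coupling for a fixed acceptance" is answered at theorem level for Lüscher's order-`N` truncated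
Wilson-flow maps (the samplers of record S3/S4; `S̃^{(k)}` ANY smooth solution of the recursion
(4.12)–(4.13) for `β·S_W`, `Φ` ANY flow map of `-∂S̃^{[N]}_t`):

* **T7 (light cone, volume-uniform)** — `∃ c ≥ 0` (`= n K_Z(T) + M_Z(T)`, polynomial in `T, |β|` of
  degree `N+1`, THEOREM-A coefficients) such that FOR EVERY `L`: inputs agreeing on the plaquette ball
  `linkBall (2(N+1)·m) e₀` give outputs with `‖Φ_t(V)_{e₀} − Φ_t(V')_{e₀}‖_F ≤ 2n·e^{ct}(ct)^m/m!` on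
  `[0, T]` (tree `TrivializingMaps.truncatedFlow_lightCone_uniform`; THEOREM L of theory-1 row 78 +
  `K_Z` row 80 + `M_Z` row 81, assembled in `TruncatedFlowLightCone`).
* **T8 (receptive field, volume-uniform)** — with the same `c`, FOR EVERY `L`, `t ∈ [0,T]` and `m` there
  is a STRICTLY LOCAL map `Ψ` of range `2(N+1)·m` (its `e`-component depends only on `linkBall (2(N+1)m) e`)
  with `‖Φ_t(V)_e − Ψ(V)_e‖_F ≤ 2n·e^{ct}(ct)^m/m!` for all `V, e`
  (`TrivializingMaps.truncatedFlow_receptiveField_uniform`) — the receptive radius for per-link accuracy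
  `ε` is a function of `d, n, B, β, T, N, ε`, NOT of `L`.
* **T9 (acceptance–footprint law)** — for any continuous action `S` (target `𝒵⁻¹e^{−S}D[U]`), if the
  exact independence sampler proposing `(Φ_t)_* D[V]` (density `q`) has equilibrium acceptance `≥ acc`,
  then every pair of bounded sup-Lipschitz observables whose `2(N+1)m`-balls are disjoint has
  `|Cov_π(A,B)| ≤ 6(1−acc)ab + 2(ℓ_A b + aℓ_B)·2n e^{ct}(ct)^m/m!`
  (`TrivializingMaps.truncatedFlow_abs_cov_boltzmann_le_of_meanAccept`; THEOREM Q of theory-1 row 88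
  composed with lean-2's expressivity barrier) — at fixed `N, t, β` the rejection rate is bounded below by
  the target's correlations beyond the cone, in every volume.

NOT part of the binding text: any value of `c`, `acc` or a correlation length at a physical `β`; any
training-cost or autocorrelation statement; anything about the exact all-orders map beyond T6's window.
-/

namespace Summit.Ventures.LatticeQCDFlow

open MeasureTheory
open Literature.MathematicalPhysics.QuantumFieldTheory
open Literature.MathematicalPhysics.QuantumFieldTheory.Luscher2010
open scoped Matrix Matrix.Norms.Frobenius Nat ContDiff

section PartT7

/-- **T7 — THE LIGHT CONE OF THE ORDER-`N` TRUNCATED WILSON FLOW, UNIFORMLY IN THE VOLUME.** -/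
def T7_TruncatedFlowLightCone : Prop :=
  ∀ (d n : ℕ), n ≠ 0 → ∀ (B : SuBasis n) (β : ℝ) (N : ℕ) (T : ℝ), 0 ≤ T →
    ∃ c : ℝ, 0 ≤ c ∧ ∀ (L : ℕ) [NeZero L] (Sk : ℕ → AmbConfig d L n → ℝ) (cs : ℕ → ℝ),
      (∀ k, ContDiff ℝ ∞ (Sk k)) →
      IsLuscherSeries B (fun W => β * TrivializingMaps.ambWilsonAction W) Sk cs →
      ∀ (Φ : ℝ → GaugeConfig d L (Matrix.specialUnitaryGroup (Fin n) ℂ) →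
          GaugeConfig d L (Matrix.specialUnitaryGroup (Fin n) ℂ)),
        IsFlowMap (fun t W => -linkGrad B (TrivializingMaps.truncFlowAction Sk t N) W) Φ →
      ∀ (e₀ : Edge d L) (m : ℕ) (V V' : GaugeConfig d L (Matrix.specialUnitaryGroup (Fin n) ℂ)),
        (∀ e ∈ linkBall (2 * (N + 1) * m) e₀, V e = V' e) →
        ∀ t ∈ Set.Icc 0 T,
          ‖WilsonFlow.coeConfig (Φ t V) e₀ - WilsonFlow.coeConfig (Φ t V') e₀‖ ≤
            2 * n * Real.exp (c * t) * (c * t) ^ m / (m ! : ℝ)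

/-- T7 holds (`TrivializingMaps.truncatedFlow_lightCone_uniform`). -/
theorem T7_TruncatedFlowLightCone_holds : T7_TruncatedFlowLightCone :=
  fun d _ hn B β N _ hT => TrivializingMaps.truncatedFlow_lightCone_uniform d hn B β N hT

/-- **T8 — THE RECEPTIVE FIELD OF THE ORDER-`N` FLOW MAP IS A STRICTLY LOCAL MAP UP TO THE CONE TAIL,
UNIFORMLY IN THE VOLUME.** -/
def T8_TruncatedFlowReceptiveField : Prop :=
  ∀ (d n : ℕ), n ≠ 0 → ∀ (B : SuBasis n) (β : ℝ) (N : ℕ) (T : ℝ), 0 ≤ T →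
    ∃ c : ℝ, 0 ≤ c ∧ ∀ (L : ℕ) [NeZero L] (Sk : ℕ → AmbConfig d L n → ℝ) (cs : ℕ → ℝ),
      (∀ k, ContDiff ℝ ∞ (Sk k)) →
      IsLuscherSeries B (fun W => β * TrivializingMaps.ambWilsonAction W) Sk cs →
      ∀ (Φ : ℝ → GaugeConfig d L (Matrix.specialUnitaryGroup (Fin n) ℂ) →
          GaugeConfig d L (Matrix.specialUnitaryGroup (Fin n) ℂ)),
        IsFlowMap (fun t W => -linkGrad B (TrivializingMaps.truncFlowAction Sk t N) W) Φ →
      ∀ t ∈ Set.Icc 0 T, ∀ m : ℕ,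
        ∃ Ψ : GaugeConfig d L (Matrix.specialUnitaryGroup (Fin n) ℂ) →
            GaugeConfig d L (Matrix.specialUnitaryGroup (Fin n) ℂ),
          (∀ e, DependsOn (fun V => Ψ V e) (linkBall (2 * (N + 1) * m) e)) ∧
          ∀ V e, ‖WilsonFlow.coeConfig (Φ t V) e - WilsonFlow.coeConfig (Ψ V) e‖ ≤
            2 * n * Real.exp (c * t) * (c * t) ^ m / (m ! : ℝ)

/-- T8 holds (`TrivializingMaps.truncatedFlow_receptiveField_uniform`). -/
theorem T8_TruncatedFlowReceptiveField_holds : T8_TruncatedFlowReceptiveField :=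
  fun d _ hn B β N _ hT => TrivializingMaps.truncatedFlow_receptiveField_uniform d hn B β N hT

/-- **T9 — THE ACCEPTANCE–FOOTPRINT LAW OF THE EXACT ORDER-`N` FLOW SAMPLERS, EVERY VOLUME.** -/
def T9_TruncatedFlowAcceptanceFootprint : Prop :=
  ∀ (d n : ℕ) (hn : n ≠ 0) (B : SuBasis n) (β : ℝ) (N : ℕ) (T : ℝ) (hT : 0 ≤ T) (L : ℕ) [NeZero L]
    (Sk : ℕ → AmbConfig d L n → ℝ) (cs : ℕ → ℝ), (∀ k, ContDiff ℝ ∞ (Sk k)) →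
    IsLuscherSeries B (fun W => β * TrivializingMaps.ambWilsonAction W) Sk cs →
    ∀ (Φ : ℝ → GaugeConfig d L (Matrix.specialUnitaryGroup (Fin n) ℂ) →
        GaugeConfig d L (Matrix.specialUnitaryGroup (Fin n) ℂ)),
      IsFlowMap (fun t W => -linkGrad B (TrivializingMaps.truncFlowAction Sk t N) W) Φ →
    ∀ (t : ℝ), t ∈ Set.Icc 0 T → Measurable (Φ t) →
    ∀ (S : GaugeConfig d L (Matrix.specialUnitaryGroup (Fin n) ℂ) → ℝ), Continuous S →
    ∀ (q : GaugeConfig d L (Matrix.specialUnitaryGroup (Fin n) ℂ) → ℝ), (∀ U, 0 ≤ q U) → Measurable q →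
    (trivialMeasure (Matrix.specialUnitaryGroup (Fin n) ℂ) d L).map (Φ t)
      = (trivialMeasure (Matrix.specialUnitaryGroup (Fin n) ℂ) d L).withDensity
          (fun U => ENNReal.ofReal (q U)) →
    ∀ (acc : ℝ), acc ≤ ∫ U, ∫ U', min (Real.exp (-S U) / (partitionFn S).toReal * q U')
        (Real.exp (-S U') / (partitionFn S).toReal * q U)
        ∂(trivialMeasure (Matrix.specialUnitaryGroup (Fin n) ℂ) d L)
        ∂(trivialMeasure (Matrix.specialUnitaryGroup (Fin n) ℂ) d L) →
    ∀ (m : ℕ) (A Bo : GaugeConfig d L (Matrix.specialUnitaryGroup (Fin n) ℂ) → ℝ),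
      Measurable A → Measurable Bo → ∀ (a b : ℝ), (∀ U, |A U| ≤ a) → (∀ U, |Bo U| ≤ b) →
    ∀ (SA SB : Set (Edge d L)), DependsOn A SA → DependsOn Bo SB → ∀ (ℓA ℓB : ℝ),
      (∀ (U U' : GaugeConfig d L (Matrix.specialUnitaryGroup (Fin n) ℂ)) (η : ℝ),
        (∀ e ∈ SA, ‖WilsonFlow.coeConfig U e - WilsonFlow.coeConfig U' e‖ ≤ η) →
          |A U - A U'| ≤ ℓA * η) →
      (∀ (U U' : GaugeConfig d L (Matrix.specialUnitaryGroup (Fin n) ℂ)) (η : ℝ),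
        (∀ e ∈ SB, ‖WilsonFlow.coeConfig U e - WilsonFlow.coeConfig U' e‖ ≤ η) →
          |Bo U - Bo U'| ≤ ℓB * η) →
      (∀ e ∈ SA, ∀ e' ∈ SB,
        Disjoint (linkBall (2 * (N + 1) * m) e) (linkBall (2 * (N + 1) * m) e')) →
      |∫ U, A U * Bo U ∂(boltzmannMeasure S) -
          (∫ U, A U ∂(boltzmannMeasure S)) * ∫ U, Bo U ∂(boltzmannMeasure S)| ≤
        6 * (1 - acc) * (a * b) +
          2 * (ℓA * (2 * n * Real.exp (TrivializingMaps.coneRate d n B β T N * t) *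
              (TrivializingMaps.coneRate d n B β T N * t) ^ m / (m ! : ℝ)) * b +
            a * (ℓB * (2 * n * Real.exp (TrivializingMaps.coneRate d n B β T N * t) *
              (TrivializingMaps.coneRate d n B β T N * t) ^ m / (m ! : ℝ))))

/-- T9 holds (`TrivializingMaps.truncatedFlow_abs_cov_boltzmann_le_of_meanAccept`). -/
theorem T9_TruncatedFlowAcceptanceFootprint_holds : T9_TruncatedFlowAcceptanceFootprint :=
  fun _ _ hn B β N _ hT _ _ _ _ hsm hser _ hΦ _ ht hΦm _ hS _ hq0 hqm hν _ hacc m _ _ hAm hBm _ _ hAa hBb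
      _ _ hA hB _ _ hAlip hBlip hsep =>
    TrivializingMaps.truncatedFlow_abs_cov_boltzmann_le_of_meanAccept hn B β N hT hsm hser hΦ ht hΦm hS
      hq0 hqm hν hacc m hAm hBm hAa hBb hA hB hAlip hBlip hsep

end PartT7

/-- **The theory conjunction with the locality theorems** (DRAFT): `TheoryStatementT6 ∧ T7 ∧ T8 ∧ T9`. -/
def TheoryStatementT9 : Prop :=
  TheoryStatementT6 ∧ T7_TruncatedFlowLightCone ∧ T8_TruncatedFlowReceptiveField ∧
    T9_TruncatedFlowAcceptanceFootprint

/-- The extended theory conjunction holds. -/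
theorem TheoryStatementT9_holds : TheoryStatementT9 :=
  ⟨TheoryStatementT6_holds, T7_TruncatedFlowLightCone_holds, T8_TruncatedFlowReceptiveField_holds,
    T9_TruncatedFlowAcceptanceFootprint_holds⟩

end Summit.Ventures.LatticeQCDFlow
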